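/-
Copyright: cell pub-balaban-gaps, seat ne8 (estimate NE7c), gen 12. Project licence.
-/
import Summits.QuantumFields.BalabanUV.T4Continuum.Spine.NE7b.CompactFibreWindowSUN

/-!
# Road (δ) on the compact-fibre carrier's two BY-VALUE letters: the window-volume letter `κ(G)` and the interaction letter `i⁺` of
# `Spine/NE7b/CompactFibreWindowSU2` ∕ `…SUN` READ AT A LIVE WINDOW (row NE7c; junction J-10)

Cell `pub-balaban-gaps` (G2), seat ne8, estimate **NE7c** (`T4IndicatorShell.ShellWeightBound`; two-run artefact, NOT PRINTED in
[Bałaban 1983–89], NOT PROVED).  Twenty-fourth proof-only file under `Spine/NE7c/`: seat ne6 gen 11's by-value letters of the OWNER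
t4-ne7b-p1 g106's reading (n) («positivity alone at the creation step», `CompactFibreCarrier`) — `κ(W_η) ≥ (η²∕16)^{#bonds}` on
`bonds → SU(2)`, `∃ C_N > 0, κ ≥ (C_N(η∕2)^{N²})^{#bonds}` on `bonds → SU(N)`, `i⁺ = #plaquettes·8βη` — consumed BY NAME at a window
LOWERED by road (δ)'s live factor; imports `CompactFibreWindowSUN` only (which carries `…SU2` and the OWNER's carrier); nothing of
Bałaban's is named; no `def`; 0 `sorry`.

THE QUESTION (seat census `HOME/ne/NE7c.md`, NEW row 44).  Road (δ) multiplies the live small-field thresholds by factors in `[λ₀, 1]`;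
a bond window «`|V(b) − 1| ≤ ε`» at a live threshold `s·ε` is, in the trace-deficit currency of `CompactFibreWindowSU2` (`η = ε²`,
`traceWindow_eq_quatBall`), the window `W_{νη}` with `ν = s² ∈ [λ₀², 1]`; below, `ν ∈ [ν₀, 1]` with `0 < ν₀` is the generic live letter.
The compact-fibre price `e^{i⁺}∕κ(W)` has the window in BOTH letters: a smaller window has SMALLER Haar volume (`κ` is a LOWER-bound use —
it can lose) and SMALLER fields on it (`i⁺` is an UPPER-bound use — it can only gain).  By how much, and is the delivered constant
assignment-free?

WHAT IS PROVED ([folklore]; ne6's theorems BY NAME at `η := νη` plus `log (νη)⁻¹ = log η⁻¹ + log ν⁻¹ ≤ log η⁻¹ + log ν₀⁻¹`):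
* §1 `SU(2)`, ONE BOND and A REGION: `neg_log_haar_traceWindow_le_live` (`−log Haar(W_{νη}) ≤ (2 log η⁻¹ + log 16) + 2 log ν₀⁻¹`),
  **`neg_log_pi_traceWindow_le_live`** (`−log κ(Π_b W_{νη}) ≤ #bonds·(2 log η⁻¹ + log 16) + #bonds·(2 log ν₀⁻¹)`): the volume letter
  LOSES the ADDITIVE, ASSIGNMENT-FREE `2 log ν₀⁻¹` PER BOND (`= 4 log λ₀⁻¹` per bond in the `|V − 1| ≤ sε` reading) — the compact analogue
  of file 2's restricted-Gaussian Jacobian row (class C8, [B16] pp. 358∕380, [B14] (3.27)∕(3.32)); `interaction_le_of_window_live`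
  (`i⁺(νη) ≤ i⁺(η)`: FREE, monotone).
* §2 THE JUNCTION AT A LIVE WINDOW: **`compactFibre_moment_le_SU2window_live`** — ne6's `compactFibre_moment_le_SU2window` on the window
  `W_{νη}` with the conclusion's constant replaced by the ASSIGNMENT-FREE `exp(i⁺ + #bonds·(2 log η⁻¹ + log 16) + #bonds·(2 log ν₀⁻¹))`,
  `i⁺` any bound of the interaction valid on the live window (in particular print's, by §1's monotonicity): ONE constant for the grid.
* §3 `SU(N)`, ALL `N`: **`exists_neg_log_pi_sball_le_live`** — `∃ C > 0, ∀ 0 < η ≤ 2, ∀ ν ∈ [ν₀, 1]`: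
  `−log κ(Π_b SB_{νη}) ≤ #bonds·(N²·log(2∕η) − log C) + #bonds·(N²·log ν₀⁻¹)` (the SAME `C = C_N` as ne6's; loss `N² log ν₀⁻¹` per bond).
* §4 reading aids: `perBond_live_le_double` (once print's window is below the live floor, `η ≤ ν₀`, the live per-bond price is at most TWICE
  print's: `(2 log η⁻¹ + log 16) + 2 log ν₀⁻¹ ≤ 2·(2 log η⁻¹ + log 16)` — print's per-bond price `O(log η(g_j)⁻¹)` GROWS along the flow, the
  live loss is a CONSTANT: class MILD, absorbed); a decided toy (`ν₀ = 1∕4`: the per-bond loss is `log 16`).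

CENSUS (row 44, NEW; `HOME/ne/NE7c.md` §19): the (n)-carrier's window-volume letter is a LOWER-bound use of a window — the one kind of
letter a lowered threshold hurts — and costs the additive `dim·log ν₀⁻¹` per degree of freedom, identical under (δ-1) and (δ-global…)
(a single-level letter, no cross-level comparison); against print's per-dof price `O(1)·log η(g_j)⁻¹ → ∞` it is MILD (at most a factor 2
once `η(g_j) ≤ ν₀`).  The interaction letter is FREE.  BY-NAME EFFECT ON THE WALL: none (junction ∕ census file).

NOT HERE (honest): which window print uses at a creation step and at which `η(g_j)`; that Bałaban's creation-level carrier IS the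
compact-fibre one (the OWNER's (A3) ∕ (A1c) readings — `CompactFibreWindowSU2`'s HONEST REMARKS apply verbatim); node O; NE7c.  VERDICT
WORD UNCHANGED: WORK-bound behind node O; INSTANCE 0∕1.  NE7c ∕ NE7b NOT PRINTED ∕ NOT PROVED; spine 0∕9; one finite T⁴ — NOT ℝ⁴, NOT
infinite volume, NOT the mass gap, NOT Clay.
HONEST DEPENDENCY (cell): continuum YM on T⁴ ⇐ BetaPertH ∧ nine spine estimates (0∕9 proved); BetaPertH ⇐ (D1) ∧ (D4) ∧ CAP+tail.
-/

set_option autoImplicit false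

open MeasureTheory Real Finset
open scoped Matrix.Norms.Frobenius
open Literature.MathematicalPhysics.QuantumFieldTheory (haarProbability)
open Summit.QuantumFields.BalabanUV.T4Continuum.NE7b.CompactFibreWindowSU2
open Summit.QuantumFields.BalabanUV.T4Continuum.NE7b.CompactFibreWindowSUN

namespace Summit.QuantumFields.BalabanUV.T4Continuum.Spine.NE7c.LiveFactorWindowVolume

noncomputable section

/-! ## §0 The one line of arithmetic: `log (νη)⁻¹ ≤ log η⁻¹ + log ν₀⁻¹` for `0 < ν₀ ≤ ν`, `0 < η` -/

/-- `log (νη)⁻¹ = log η⁻¹ + log ν⁻¹ ≤ log η⁻¹ + log ν₀⁻¹` for `0 < ν₀ ≤ ν` and `0 < η`. [folklore] -/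
theorem log_inv_mul_le {ν ν₀ η : ℝ} (hν₀ : 0 < ν₀) (hν : ν₀ ≤ ν) (hη : 0 < η) :
    Real.log (ν * η)⁻¹ ≤ Real.log η⁻¹ + Real.log ν₀⁻¹ := by
  have hνpos : 0 < ν := hν₀.trans_le hν
  rw [mul_inv, Real.log_mul (inv_ne_zero hνpos.ne') (inv_ne_zero hη.ne'), Real.log_inv, Real.log_inv, Real.log_inv]
  have h := Real.log_le_log hν₀ hν
  linarith

/-! ## §1 `SU(2)`: the volume letter LOSES `2 log ν₀⁻¹` per bond (assignment-free); the interaction letter is FREE -/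

/-- **ONE BOND AT A LIVE WINDOW**: `−log Haar_{SU(2)}(W_{νη}) ≤ (2 log η⁻¹ + log 16) + 2 log ν₀⁻¹` for `0 < η ≤ 1∕4` and any live factor
`ν ∈ [ν₀, 1]`, `ν₀ > 0` — ne6's `neg_log_haar_traceWindow_le` at `νη` plus §0. [folklore] -/
theorem neg_log_haar_traceWindow_le_live {η ν ν₀ : ℝ} (hη0 : 0 < η) (hη : η ≤ 1 / 4) (hν₀ : 0 < ν₀) (hν : ν₀ ≤ ν) (hν1 : ν ≤ 1) :
    -Real.log ((haarProbability (Matrix.specialUnitaryGroup (Fin 2) ℂ))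
        {U : Matrix.specialUnitaryGroup (Fin 2) ℂ | 2 - ((U : Matrix (Fin 2) (Fin 2) ℂ).trace).re ≤ ν * η}).toReal
      ≤ (2 * Real.log η⁻¹ + Real.log 16) + 2 * Real.log ν₀⁻¹ := by
  have hνpos : 0 < ν := hν₀.trans_le hν
  have hνη0 : 0 < ν * η := mul_pos hνpos hη0
  have hνη : ν * η ≤ 1 / 4 := (mul_le_of_le_one_left hη0.le hν1).trans hη
  have h := neg_log_haar_traceWindow_le hνη0 hνη
  have hl := log_inv_mul_le hν₀ hν hη0
  linarith

variable {B : Type*} [Fintype B]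

/-- **A REGION AT A LIVE WINDOW: THE PER-DEGREE-OF-FREEDOM LOSS, ASSIGNMENT-FREE.**
`−log κ(Π_b W_{νη}) ≤ #bonds·(2 log η⁻¹ + log 16) + #bonds·(2 log ν₀⁻¹)` for the product Haar window on `bonds → SU(2)`, `0 < η ≤ 1∕4`,
every live factor `ν ∈ [ν₀, 1]` — ne6's `neg_log_pi_traceWindow_le` at `νη` plus §0: ONE volume letter for the grid. [folklore] -/
theorem neg_log_pi_traceWindow_le_live {η ν ν₀ : ℝ} (hη0 : 0 < η) (hη : η ≤ 1 / 4) (hν₀ : 0 < ν₀) (hν : ν₀ ≤ ν) (hν1 : ν ≤ 1) :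
    -Real.log ((Measure.pi fun _ : B => haarProbability (Matrix.specialUnitaryGroup (Fin 2) ℂ))
        (Set.univ.pi fun _ : B => {U : Matrix.specialUnitaryGroup (Fin 2) ℂ | 2 - ((U : Matrix (Fin 2) (Fin 2) ℂ).trace).re ≤ ν * η})).toReal
      ≤ (Fintype.card B : ℝ) * (2 * Real.log η⁻¹ + Real.log 16) + (Fintype.card B : ℝ) * (2 * Real.log ν₀⁻¹) := by
  have hνpos : 0 < ν := hν₀.trans_le hν
  have hνη0 : 0 < ν * η := mul_pos hνpos hη0
  have hνη : ν * η ≤ 1 / 4 := (mul_le_of_le_one_left hη0.le hν1).trans hη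
  have h := neg_log_pi_traceWindow_le (B := B) hνη0 hνη
  have hl : 2 * Real.log (ν * η)⁻¹ + Real.log 16 ≤ (2 * Real.log η⁻¹ + Real.log 16) + 2 * Real.log ν₀⁻¹ := by
    linarith [log_inv_mul_le hν₀ hν hη0]
  have hc : (0 : ℝ) ≤ Fintype.card B := Nat.cast_nonneg _
  calc _ ≤ (Fintype.card B : ℝ) * (2 * Real.log (ν * η)⁻¹ + Real.log 16) := h
    _ ≤ (Fintype.card B : ℝ) * ((2 * Real.log η⁻¹ + Real.log 16) + 2 * Real.log ν₀⁻¹) := mul_le_mul_of_nonneg_left hl hc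
    _ = _ := by ring

/-- **THE INTERACTION LETTER AT A LIVE WINDOW IS FREE** (monotone): bonds in the live window `W_{νη}`, `ν ≤ 1`, give
`Σ_{p ∈ s} β(1 − ½Re tr U_p) ≤ #s·8βη` — print's `i⁺` unchanged (ne6's `interaction_le_of_window` at `νη`, then `νη ≤ η`). [folklore] -/
theorem interaction_le_of_window_live {P : Type*} (s : Finset P) {β η ν : ℝ} (hβ : 0 ≤ β) (hη : 0 ≤ η) (hν0 : 0 ≤ ν) (hν1 : ν ≤ 1)
    (b₁ b₂ b₃ b₄ : P → (Matrix.specialUnitaryGroup (Fin 2) ℂ))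
    (h : ∀ p ∈ s, b₁ p ∈ {U : Matrix.specialUnitaryGroup (Fin 2) ℂ | 2 - ((U : Matrix (Fin 2) (Fin 2) ℂ).trace).re ≤ ν * η} ∧
      b₂ p ∈ {U : Matrix.specialUnitaryGroup (Fin 2) ℂ | 2 - ((U : Matrix (Fin 2) (Fin 2) ℂ).trace).re ≤ ν * η} ∧
      b₃ p ∈ {U : Matrix.specialUnitaryGroup (Fin 2) ℂ | 2 - ((U : Matrix (Fin 2) (Fin 2) ℂ).trace).re ≤ ν * η} ∧
      b₄ p ∈ {U : Matrix.specialUnitaryGroup (Fin 2) ℂ | 2 - ((U : Matrix (Fin 2) (Fin 2) ℂ).trace).re ≤ ν * η}) :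
    ∑ p ∈ s, β * (1 - (1 / 2 : ℝ) * (((b₁ p * b₂ p * b₃ p * b₄ p : Matrix.specialUnitaryGroup (Fin 2) ℂ) : Matrix (Fin 2) (Fin 2) ℂ).trace).re)
      ≤ (s.card : ℝ) * (8 * β * η) := by
  have hνη : 0 ≤ ν * η := mul_nonneg hν0 hη
  have h1 := interaction_le_of_window s hβ hνη b₁ b₂ b₃ b₄ h
  have hle : (s.card : ℝ) * (8 * β * (ν * η)) ≤ (s.card : ℝ) * (8 * β * η) := by
    have hc : (0 : ℝ) ≤ s.card := Nat.cast_nonneg _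
    have : 8 * β * (ν * η) ≤ 8 * β * η := by nlinarith [mul_le_of_le_one_left hη hν1]
    exact mul_le_mul_of_nonneg_left this hc
  exact h1.trans hle

/-! ## §2 The junction at a live window: ONE assignment-free constant -/

/-- **THE COMPACT-FIBRE PRICE AT A LIVE WINDOW, `SU(2)`, ASSIGNMENT-FREE.**  ne6's `compactFibre_moment_le_SU2window` on the live window
`W_{νη}` (`0 < η ≤ 1∕4`, `ν ∈ [ν₀, 1]`, `ν₀ > 0`): near fibre `bonds → SU(2)` with the product Haar probability, numerator factor `0 ≤ F ≤ 1`
carried by POSITIVITY, interaction `≤ i⁺` on the LIVE window; then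
`∫ F·w·e^{−I} ≤ exp(i⁺ + #bonds·(2 log η⁻¹ + log 16) + #bonds·(2 log ν₀⁻¹)) · ∫ 𝟙_{W_{νη}}·w·e^{−I}` — the SAME constant for every
assignment of the grid. [folklore] -/
theorem compactFibre_moment_le_SU2window_live {Y : Type*} [MeasurableSpace Y] (μ : Measure Y) [SFinite μ]
    {η ν ν₀ : ℝ} (hη0 : 0 < η) (hη : η ≤ 1 / 4) (hν₀ : 0 < ν₀) (hν : ν₀ ≤ ν) (hν1 : ν ≤ 1)
    (F : (B → (Matrix.specialUnitaryGroup (Fin 2) ℂ)) → ℝ) (w : Y → ℝ) (I : (B → (Matrix.specialUnitaryGroup (Fin 2) ℂ)) × Y → ℝ) {ip : ℝ}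
    (hF0 : ∀ x, 0 ≤ F x) (hF1 : ∀ x, F x ≤ 1) (hFi : Integrable F (Measure.pi fun _ : B => haarProbability (Matrix.specialUnitaryGroup (Fin 2) ℂ)))
    (hw0 : ∀ y, 0 ≤ w y)
    (hIpos : ∀ z : (B → (Matrix.specialUnitaryGroup (Fin 2) ℂ)) × Y, F z.1 ≠ 0 → w z.2 ≠ 0 → 0 ≤ I z)
    (hIsmall : ∀ z : (B → (Matrix.specialUnitaryGroup (Fin 2) ℂ)) × Y, z.1 ∈ (Set.univ.pi fun _ : B => {U : Matrix.specialUnitaryGroup (Fin 2) ℂ | 2 - ((U : Matrix (Fin 2) (Fin 2) ℂ).trace).re ≤ ν * η}) → w z.2 ≠ 0 → I z ≤ ip)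
    (hA : Integrable (fun z : (B → (Matrix.specialUnitaryGroup (Fin 2) ℂ)) × Y => F z.1 * w z.2) ((Measure.pi fun _ : B => haarProbability (Matrix.specialUnitaryGroup (Fin 2) ℂ)).prod μ))
    (hB' : Integrable (fun z : (B → (Matrix.specialUnitaryGroup (Fin 2) ℂ)) × Y => (Set.univ.pi fun _ : B => {U : Matrix.specialUnitaryGroup (Fin 2) ℂ | 2 - ((U : Matrix (Fin 2) (Fin 2) ℂ).trace).re ≤ ν * η}).indicator 1 z.1 * w z.2 * exp (-I z))
      ((Measure.pi fun _ : B => haarProbability (Matrix.specialUnitaryGroup (Fin 2) ℂ)).prod μ)) :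
    ∫ z, F z.1 * w z.2 * exp (-I z) ∂((Measure.pi fun _ : B => haarProbability (Matrix.specialUnitaryGroup (Fin 2) ℂ)).prod μ) ≤
      exp (ip + (Fintype.card B : ℝ) * (2 * Real.log η⁻¹ + Real.log 16) + (Fintype.card B : ℝ) * (2 * Real.log ν₀⁻¹)) *
        ∫ z, (Set.univ.pi fun _ : B => {U : Matrix.specialUnitaryGroup (Fin 2) ℂ | 2 - ((U : Matrix (Fin 2) (Fin 2) ℂ).trace).re ≤ ν * η}).indicator 1 z.1 * w z.2 * exp (-I z)
          ∂((Measure.pi fun _ : B => haarProbability (Matrix.specialUnitaryGroup (Fin 2) ℂ)).prod μ) := by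
  have hνpos : 0 < ν := hν₀.trans_le hν
  have hνη0 : 0 < ν * η := mul_pos hνpos hη0
  have hνη : ν * η ≤ 1 / 4 := (mul_le_of_le_one_left hη0.le hν1).trans hη
  have key := compactFibre_moment_le_SU2window μ hνη0 hνη F w I hF0 hF1 hFi hw0 hIpos hIsmall hA hB'
  have hR0 : 0 ≤ ∫ z, (Set.univ.pi fun _ : B => {U : Matrix.specialUnitaryGroup (Fin 2) ℂ | 2 - ((U : Matrix (Fin 2) (Fin 2) ℂ).trace).re ≤ ν * η}).indicator (1 : (B → Matrix.specialUnitaryGroup (Fin 2) ℂ) → ℝ) z.1 * w z.2 * exp (-I z)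
      ∂((Measure.pi fun _ : B => haarProbability (Matrix.specialUnitaryGroup (Fin 2) ℂ)).prod μ) :=
    integral_nonneg fun z => mul_nonneg (mul_nonneg (Set.indicator_nonneg (fun _ _ => zero_le_one) _) (hw0 _)) (exp_pos _).le
  refine key.trans (mul_le_mul_of_nonneg_right (Real.exp_le_exp.mpr ?_) hR0)
  have hl : 2 * Real.log (ν * η)⁻¹ + Real.log 16 ≤ (2 * Real.log η⁻¹ + Real.log 16) + 2 * Real.log ν₀⁻¹ := by
    linarith [log_inv_mul_le hν₀ hν hη0]
  have hc : (0 : ℝ) ≤ Fintype.card B := Nat.cast_nonneg _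
  have := mul_le_mul_of_nonneg_left hl hc
  linarith

/-! ## §3 `SU(N)`, all `N`: the same loss, `N² log ν₀⁻¹` per bond, with ne6's own constant `C_N` -/

/-- **THE PER-DEGREE-OF-FREEDOM PRICE AT A LIVE WINDOW, ALL `N`**: `∃ C > 0` (ne6's `C_N`) such that for every print window `0 < η ≤ 2`
and every live factor `ν ∈ [ν₀, 1]` (`ν₀ > 0`) the product Hilbert–Schmidt window `Π_b {‖V − 1‖ ≤ νη}` on `bonds → SU(N)` has positive mass
and `−log κ ≤ #bonds·(N²·log(2∕η) − log C) + #bonds·(N²·log ν₀⁻¹)`. [folklore] -/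
theorem exists_neg_log_pi_sball_le_live {N : ℕ} {ν₀ : ℝ} (hν₀ : 0 < ν₀) :
    ∃ C : ℝ, 0 < C ∧ ∀ η : ℝ, 0 < η → η ≤ 2 → ∀ ν : ℝ, ν₀ ≤ ν → ν ≤ 1 →
      0 < ((Measure.pi fun _ : B => haarProbability (Matrix.specialUnitaryGroup (Fin N) ℂ))
          (Set.univ.pi fun _ : B => {V : Matrix.specialUnitaryGroup (Fin N) ℂ | ‖(V : Matrix (Fin N) (Fin N) ℂ) - 1‖ ≤ ν * η})).toReal ∧
        -Real.log ((Measure.pi fun _ : B => haarProbability (Matrix.specialUnitaryGroup (Fin N) ℂ))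
            (Set.univ.pi fun _ : B => {V : Matrix.specialUnitaryGroup (Fin N) ℂ | ‖(V : Matrix (Fin N) (Fin N) ℂ) - 1‖ ≤ ν * η})).toReal
          ≤ (Fintype.card B : ℝ) * ((N * N : ℝ) * Real.log (2 / η) - Real.log C) + (Fintype.card B : ℝ) * ((N * N : ℝ) * Real.log ν₀⁻¹) := by
  obtain ⟨C, hC, h⟩ := exists_neg_log_pi_sball_le (N := N) (B := B)
  refine ⟨C, hC, fun η hη hη2 ν hν hν1 => ?_⟩
  have hνpos : 0 < ν := hν₀.trans_le hν
  have hνη0 : 0 < ν * η := mul_pos hνpos hη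
  have hνη2 : ν * η ≤ 2 := (mul_le_of_le_one_left hη.le hν1).trans hη2
  obtain ⟨hpos, hlog⟩ := h (ν * η) hνη0 hνη2
  refine ⟨hpos, hlog.trans ?_⟩
  have hl : Real.log (2 / (ν * η)) ≤ Real.log (2 / η) + Real.log ν₀⁻¹ := by
    rw [show (2 : ℝ) / (ν * η) = 2 / η * ν⁻¹ by field_simp, Real.log_mul (by positivity) (inv_ne_zero hνpos.ne'),
      Real.log_inv, Real.log_inv]
    linarith [Real.log_le_log hν₀ hν]
  have hNN : (0 : ℝ) ≤ (N * N : ℝ) := by positivity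
  have hc : (0 : ℝ) ≤ Fintype.card B := Nat.cast_nonneg _
  have h1 : (N * N : ℝ) * Real.log (2 / (ν * η)) - Real.log C
      ≤ ((N * N : ℝ) * Real.log (2 / η) - Real.log C) + (N * N : ℝ) * Real.log ν₀⁻¹ := by
    have := mul_le_mul_of_nonneg_left hl hNN
    linarith
  calc (Fintype.card B : ℝ) * ((N * N : ℝ) * Real.log (2 / (ν * η)) - Real.log C)
      ≤ (Fintype.card B : ℝ) * (((N * N : ℝ) * Real.log (2 / η) - Real.log C) + (N * N : ℝ) * Real.log ν₀⁻¹) :=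
        mul_le_mul_of_nonneg_left h1 hc
    _ = _ := by ring

/-! ## §4 Reading aids and sanity -/

/-- **MILD**: once print's window is below the live floor (`0 < η ≤ ν₀`) the live per-bond price is at most TWICE print's per-bond
price — print's `2 log η(g_j)⁻¹ + log 16` grows along the flow, the loss `2 log ν₀⁻¹` is a constant. [folklore] -/
theorem perBond_live_le_double {η ν₀ : ℝ} (hη0 : 0 < η) (hην : η ≤ ν₀) :
    (2 * Real.log η⁻¹ + Real.log 16) + 2 * Real.log ν₀⁻¹ ≤ 2 * (2 * Real.log η⁻¹ + Real.log 16) := by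
  have h1 : Real.log ν₀⁻¹ ≤ Real.log η⁻¹ := by
    rw [Real.log_inv, Real.log_inv]
    linarith [Real.log_le_log hη0 hην]
  have h16 : 0 ≤ Real.log 16 := Real.log_nonneg (by norm_num)
  linarith

/-- In the `|V − 1| ≤ s·ε` reading (`η = ε²`, `ν = s²`, `ν₀ = λ₀²`) the per-bond loss `2 log ν₀⁻¹` is `4 log λ₀⁻¹`. [folklore] -/
theorem perBond_loss_sq (lam0 : ℝ) : 2 * Real.log (lam0 ^ 2)⁻¹ = 4 * Real.log lam0⁻¹ := by
  rw [Real.log_inv, Real.log_inv, Real.log_pow]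
  push_cast
  ring

/-- Decided toy: at the live floor `ν₀ = 1∕4` the per-bond loss is exactly `log 16` — the same size as the additive constant already in
ne6's per-bond price. -/
example : 2 * Real.log (1 / 4 : ℝ)⁻¹ = Real.log 16 := by
  rw [one_div, inv_inv, show (16 : ℝ) = 4 ^ 2 by norm_num, Real.log_pow]
  push_cast
  ring

end

end Summit.QuantumFields.BalabanUV.T4Continuum.Spine.NE7c.LiveFactorWindowVolume
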